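import Mathlib
import Literature.MathematicalPhysics.KineticTheory.KickMatchedHardSphereGas
import HarnessLib

/-!
# Joint measurability of the kick-matched hard-sphere flow `Z*_t(z; u)` (fact W1, with its proof)

Topic `MathematicalPhysics/KineticTheory`. The named fact `KickMatchedMeasurable` — clause (i) of
`KickMatchedStationary` for the kick-matched hard-sphere gas `Z*` of
`Literature.MathematicalPhysics.KineticTheory.KickMatchedHardSphereGas`: for every `0 < σ < 1/2`,
`N`,
`t`, the time-`t` map `(z, u) ↦ kmFlow σ N u z t` is jointly measurable in (datum, dice) — together
with its discharge `KickMatchedMeasurable_holds`.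

Provenance (librarian move out of `Literature/Uncategorized`, 2026-08-16): the fact was relocated by
the
gate to `Literature.Uncategorized.KickMatchedMeasurable` (accept-time relocation of an inline
`[cite]`d
proposition of a Summits proposal, p76493, no `[topic]` hint) and discharged in
`Literature.Uncategorized.KickMatchedMeasurableProofs`; both are copied here VERBATIM (statement,
proof
and docstrings), only the namespace is the directory's. The two `Uncategorized` modules become
deprecated
aliases of these declarations in a follow-up proposal (their importers —
`KineticTheory/KickMatchedHardSphereGasStatements.lean` and two Summits files — keep elaborating
meanwhile).

## The (folklore) argument, as formalized

`kmFlow σ N = Driven.flow geo (hsDiameter σ N) (kmRule σ N)` is the library's noise-driven collision recursion, whose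
time-`t` map is jointly measurable for a hard-sphere regular, measurable geometry and a jointly measurable rule
(`Driven.measurable_flow`, `StochasticCollisionHardSphereProcess`). The torus geometry is measurable
(`Torus.isMeasurable_geometry`) and regular at every diameter `< 1/2` (`Torus.isHardSphereRegular_geometry`; here
`hsDiameter σ N ≤ σ < 1/2`, `hsDiameter_le`). It remains to see that `kmRule σ N i j y d = kickAt σ N i j (kmNormal …) y`
is jointly measurable in `(y, d)` (`measurableRule_kmRule`):

* `measurable_lambertLift₂` — Lambert's lift `(ω, q) ↦ Lambert.lift ω q` is JOINTLY Borel (the polar frame `e₁, e₂` is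
  piecewise algebraic with a constant fallback on the measurable pole set `rho ω = 0`); the tree only had
  `Lambert.measurable_lift a` for a fixed axis (`LambertCosineLaw`), whereas `kmNormal` lifts about the datum-dependent
  axis `a = (w − v)/|w − v|`.
* `measurable_kickAt` — `kickAt` is `collidePair` (`Geometry.IsMeasurable.measurable_collidePair`) after a
  `Function.update` of the partner by a measurable translate (`measurable_update'`).
* `measurableSet_isAdmissible` — a norm condition, an open half-space condition, and the preimage of the measurable
  hard-sphere domain (`measurableSet_hardSphereDomain`) under the measurable kick.
* `measurable_dite_find` — the abstract rejection sampler `x ↦ if h : ∃ n, P n x then F (Nat.find h) x else J x` is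
  measurable for measurable events/branches (`Measurable.find` on the success set, `measurable_of_restrict_of_restrict_compl`),
  for arbitrary decidability instances; `measurable_kmNormal` is this with the events
  `‖d n‖ ≤ 1 ∧ IsAdmissible … (Lambert.lift a (d n)) y`.

A parallel problem-side proof exists in
`Summits/AtomisticToContinuum/HydrodynamicLimit/Theorems/InformationPercolationEnginePercolationClosesChaosKickMatchedMeasurable.lean`
(`stub_kickMatchedMeasurable`, p77698); Literature cannot import Summits, so the discharge is re-proved here upstream and
that stub may be shortened to `KickMatchedMeasurable_holds`.

## References

Standard measure theory (measurability of piecewise-defined maps, of `Nat.find` first-hit selections —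
`Measurable.find` in Mathlib — and of compositions); the collision recursion of C. Cercignani, R. Illner,
M. Pulvirenti, *The Mathematical Theory of Dilute Gases* (1994), App. 4.A, in its noise-driven form `Driven.flow`.
Every declaration is `[folklore]`.
-/

namespace Literature.MathematicalPhysics.KineticTheory

open scoped BigOperators ENNReal Topology RealInnerProductSpace
open _root_.MeasureTheory Set Filter
open Literature.Analysis.FluidPDE
open Literature.MathematicalPhysics.KineticTheory.KickMatchedHardSphereGas

/-- **W1 · `KickMatchedMeasurable`** — clause (i) of `KickMatchedStationary`, for every `0 < σ < 1/2` (so that the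
diameter `hsDiameter σ N ≤ σ < 1/2` keeps the torus geometry hard-sphere regular, `Torus.isHardSphereRegular_geometry`),
every `N` and `t`: the time-`t` map `(z, u) ↦ Z*_t(z; u) = kmFlow σ N u z t` is jointly measurable. By
`Driven.measurable_flow` (StochasticCollisionHardSphereProcess) this is exactly `Driven.MeasurableRule (kmRule σ N)`:
`kickAt` is measurable (`Torus.isMeasurable_geometry`, `measurable_collidePair`, `Function.update`) and `kmNormal` is a
`Nat.find` over the measurable predicates `‖d n‖ ≤ 1 ∧ IsAdmissible … (Lambert.lift a (d n)) y`. [folklore] -/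
def KickMatchedMeasurable : Prop :=
  ∀ σ : ℝ, 0 < σ → σ < 1 / 2 → ∀ (N : ℕ) (t : ℝ), Measurable fun q : Cfg N × (ℕ → Die) => kmFlow σ N q.2 q.1 t

/-! ## Measurability of Lambert's lift

The frame `(e₁ ω, e₂ ω, ω)` of `DicedHardSphereDynamics` is piecewise algebraic in `ω` (polar frame, constant
fallback on the measurable pole set `rho ω = 0`), so `(ω, q) ↦ Lambert.lift ω q` is jointly Borel; the tree only had
`Lambert.measurable_lift a` for a FIXED axis `a` (`LambertCosineLaw`), whereas `kmNormal` lifts about the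
datum-dependent axis `a = (w − v)/|w − v|`. -/

/-- A vector of `ℝ³` with measurable coordinates is a measurable function. [folklore] -/
private theorem measurable_vec3 {α : Type*} [MeasurableSpace α] {f g h : α → ℝ} (hf : Measurable f)
    (hg : Measurable g) (hh : Measurable h) : Measurable fun a => (WithLp.toLp 2 ![f a, g a, h a] : V3) := by
  refine (WithLp.measurable_toLp 2 _).comp (measurable_pi_lambda _ fun i => ?_)
  fin_cases i
  · exact hf
  · exact hg
  · exact hh

/-- The cylindrical radius `rho ω = √(ω₀² + ω₁²)` is measurable (indeed continuous). [folklore] -/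
theorem measurable_lambertRho : Measurable Lambert.rho := by
  unfold Lambert.rho
  fun_prop

/-- The first frame leg `e₁` is measurable (piecewise: constant on the pole set `rho = 0`, algebraic off it).
[folklore] -/
theorem measurable_lambertE₁ : Measurable Lambert.e₁ := by
  have h0 : Measurable fun ω : V3 => ω 0 := by fun_prop
  have h1 : Measurable fun ω : V3 => ω 1 := by fun_prop
  unfold Lambert.e₁
  refine Measurable.ite (measurableSet_eq_fun measurable_lambertRho measurable_const) measurable_const ?_
  exact measurable_vec3 (h1.neg.div measurable_lambertRho) (h0.div measurable_lambertRho) measurable_const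

/-- The second frame leg `e₂` is measurable. [folklore] -/
theorem measurable_lambertE₂ : Measurable Lambert.e₂ := by
  have h0 : Measurable fun ω : V3 => ω 0 := by fun_prop
  have h1 : Measurable fun ω : V3 => ω 1 := by fun_prop
  have h2 : Measurable fun ω : V3 => ω 2 := by fun_prop
  unfold Lambert.e₂
  refine Measurable.ite (measurableSet_eq_fun measurable_lambertRho measurable_const)
    (measurable_vec3 measurable_const h2 measurable_const) ?_
  exact measurable_vec3 ((h0.mul h2).neg.div measurable_lambertRho) ((h1.mul h2).neg.div measurable_lambertRho)
    measurable_lambertRho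

/-- The embedding `(ω, q) ↦ q₀ e₁ ω + q₁ e₂ ω` of the disc plane is jointly measurable. [folklore] -/
theorem measurable_lambertEmbed₂ :
    Measurable fun p : V3 × EuclideanSpace ℝ (Fin 2) => Lambert.embed p.1 p.2 := by
  have hq0 : Measurable fun p : V3 × EuclideanSpace ℝ (Fin 2) => p.2 0 := by fun_prop
  have hq1 : Measurable fun p : V3 × EuclideanSpace ℝ (Fin 2) => p.2 1 := by fun_prop
  unfold Lambert.embed
  exact (hq0.smul (measurable_lambertE₁.comp measurable_fst)).add (hq1.smul (measurable_lambertE₂.comp measurable_fst))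

/-- **Lambert's lift is jointly measurable** in the axis and the disc point:
`(ω, q) ↦ Lambert.lift ω q = embed ω q + √(1 − ‖q‖²) ω`. [folklore] -/
theorem measurable_lambertLift₂ :
    Measurable fun p : V3 × EuclideanSpace ℝ (Fin 2) => Lambert.lift p.1 p.2 := by
  unfold Lambert.lift
  exact measurable_lambertEmbed₂.add
    ((measurable_const.sub (measurable_snd.norm.pow_const 2)).sqrt.smul measurable_fst)

/-! ## Measurability of the kick, of admissibility and of the rejection sampler -/

/-- **The kick is jointly measurable** in (configuration, normal): `kickAt` is `collidePair` (measurable,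
`Geometry.IsMeasurable.measurable_collidePair`) after a `Function.update` of the partner by a measurable translate.
[folklore] -/
theorem measurable_kickAt (σ : ℝ) (N : ℕ) (i j : Fin (N + 1)) :
    Measurable fun q : Cfg N × V3 => kickAt σ N i j q.2 q.1 := by
  have hG : geo.IsMeasurable := Torus.isMeasurable_geometry
  unfold kickAt
  refine (hG.measurable_collidePair i j).comp ?_
  refine measurable_update'.comp (measurable_fst.prodMk ?_)
  exact (hG.measurable_translate.comp
    (((Geometry.IsMeasurable.measurable_pos i).comp measurable_fst).prodMk
      (measurable_snd.const_smul (hsDiameter σ N)).neg)).prodMk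
    ((Geometry.IsMeasurable.measurable_vel j).comp measurable_fst)

/-- **Admissibility is a measurable event** in (configuration, normal): a norm condition, an open half-space
condition and the preimage of the (closed, measurable) hard-sphere domain under the measurable kick. [folklore] -/
theorem measurableSet_isAdmissible (σ : ℝ) (N : ℕ) (i j : Fin (N + 1)) :
    MeasurableSet {q : Cfg N × V3 | IsAdmissible σ N i j q.2 q.1} := by
  have h1 : MeasurableSet {q : Cfg N × V3 | ‖q.2‖ = 1} :=
    measurableSet_eq_fun measurable_snd.norm measurable_const
  have hw : Measurable fun q : Cfg N × V3 => (q.1 j).2 - (q.1 i).2 :=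
    ((Geometry.IsMeasurable.measurable_vel j).sub (Geometry.IsMeasurable.measurable_vel i)).comp measurable_fst
  have h2 : MeasurableSet {q : Cfg N × V3 | 0 < ⟪(q.1 j).2 - (q.1 i).2, q.2⟫} :=
    measurableSet_lt measurable_const (hw.inner measurable_snd)
  have h3 : MeasurableSet
      {q : Cfg N × V3 | kickAt σ N i j q.2 q.1 ∈ hardSphereDomain geo (N + 1) (hsDiameter σ N)} :=
    measurable_kickAt σ N i j
      (measurableSet_hardSphereDomain geo Torus.measurable_geometry_sepVec (N + 1) (hsDiameter σ N))
  unfold IsAdmissible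
  exact measurableSet_setOf.2
    ((measurableSet_setOf.1 h1).and ((measurableSet_setOf.1 h2).and (measurableSet_setOf.1 h3)))

/-- **Measurability of a first-success selection** (the abstract rejection sampler): if the events
`{x | P n x}` are measurable and `F n`, `J` are measurable, then `x ↦ F (Nat.find h) x` on `{x | ∃ n, P n x}` (first
index that succeeds) and `x ↦ J x` off it is measurable. The decidability instances are arbitrary (implicit, unified
from the use site). [folklore] -/
theorem measurable_dite_find {α β : Type*} [MeasurableSpace α] [MeasurableSpace β] {P : ℕ → α → Prop}
    {hdec : ∀ x, Decidable (∃ n, P n x)} {hdp : ∀ x n, Decidable (P n x)} {F : ℕ → α → β} {J : α → β}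
    (hP : ∀ n, MeasurableSet {x | P n x}) (hF : ∀ n, Measurable (F n)) (hJ : Measurable J) :
    Measurable fun x => @dite β (∃ n, P n x) (hdec x)
      (fun h => F (@Nat.find (fun n => P n x) (hdp x) h) x) fun _ => J x := by
  set S : Set α := {x | ∃ n, P n x} with hS_def
  have hS : MeasurableSet S := by
    have : S = ⋃ n, {x | P n x} := by
      ext x
      simp [hS_def]
    rw [this]
    exact MeasurableSet.iUnion hP
  refine measurable_of_restrict_of_restrict_compl hS ?_ ?_
  · have h1 : ∀ x : S, ∃ n, P n (x : α) := fun x => x.2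
    have heq : (S.restrict fun x => @dite β (∃ n, P n x) (hdec x)
        (fun h => F (@Nat.find (fun n => P n x) (hdp x) h) x) fun _ => J x) =
        fun x : S => F (@Nat.find (fun n => P n (x : α)) (hdp x) (h1 x)) x := by
      funext x
      exact @dif_pos (∃ n, P n (x : α)) (hdec _) (h1 x) _ _ _
    rw [heq]
    exact @Measurable.find _ _ _ _ (fun n (x : S) => F n x) (fun n (x : S) => P n (x : α)) (fun n x => hdp x n)
      (fun n => (hF n).comp measurable_subtype_coe) (fun n => measurable_subtype_coe (hP n)) h1
  · have h2 : ∀ x : (Sᶜ : Set α), ¬ ∃ n, P n (x : α) := fun x => x.2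
    have heq : (Sᶜ.restrict fun x => @dite β (∃ n, P n x) (hdec x)
        (fun h => F (@Nat.find (fun n => P n x) (hdp x) h) x) fun _ => J x) =
        fun x : (Sᶜ : Set α) => J x := by
      funext x
      exact @dif_neg (∃ n, P n (x : α)) (hdec _) (h2 x) _ _ _
    rw [heq]
    exact hJ.comp measurable_subtype_coe

/-- **The resampled normal `kmNormal` is jointly measurable** in (configuration, die): it is the first-success
selection (`measurable_dite_find`) over the measurable events
`‖d n‖ ≤ 1 ∧ IsAdmissible … (Lambert.lift a (d n)) y` (`measurableSet_isAdmissible`, `measurable_lambertLift₂`, the axis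
`a = (w − v)/|w − v|` measurable in `y`), with the measurable junk value `ε⁻¹ sepVec`. [folklore] -/
theorem measurable_kmNormal (σ : ℝ) (N : ℕ) (i j : Fin (N + 1)) :
    Measurable fun q : Cfg N × Die => kmNormal σ N i j q.1 q.2 := by
  have hG : geo.IsMeasurable := Torus.isMeasurable_geometry
  have hw : Measurable fun q : Cfg N × Die => (q.1 j).2 - (q.1 i).2 :=
    ((Geometry.IsMeasurable.measurable_vel j).sub (Geometry.IsMeasurable.measurable_vel i)).comp measurable_fst
  have ha : Measurable fun q : Cfg N × Die => ‖(q.1 j).2 - (q.1 i).2‖⁻¹ • ((q.1 j).2 - (q.1 i).2) :=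
    hw.norm.inv.smul hw
  -- Elaborate the composition WITHOUT the expected type, then `exact`: unifying a metavariable-headed
  -- composition against a `Lambert.lift`-headed lambda makes the unifier unfold `lift` (the `PiLp` norm,
  -- `Real.sqrt`, …) and time out, whereas the fully elaborated term is matched structurally.
  have hL : ∀ n : ℕ, Measurable fun q : Cfg N × Die =>
      Lambert.lift (‖(q.1 j).2 - (q.1 i).2‖⁻¹ • ((q.1 j).2 - (q.1 i).2)) (q.2 n) := fun n => by
    have h := measurable_lambertLift₂.fun_comp (ha.prodMk ((measurable_pi_apply n).comp measurable_snd))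
    exact h
  have hP : ∀ n : ℕ, MeasurableSet {q : Cfg N × Die | ‖q.2 n‖ ≤ 1 ∧
      IsAdmissible σ N i j
        (Lambert.lift (‖(q.1 j).2 - (q.1 i).2‖⁻¹ • ((q.1 j).2 - (q.1 i).2)) (q.2 n)) q.1} := by
    intro n
    have h1 : MeasurableSet {q : Cfg N × Die | ‖q.2 n‖ ≤ 1} :=
      measurableSet_le ((measurable_pi_apply n).comp measurable_snd).norm measurable_const
    have h2 : MeasurableSet {q : Cfg N × Die | IsAdmissible σ N i j
        (Lambert.lift (‖(q.1 j).2 - (q.1 i).2‖⁻¹ • ((q.1 j).2 - (q.1 i).2)) (q.2 n)) q.1} :=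
      (measurable_fst.prodMk (hL n)) (measurableSet_isAdmissible σ N i j)
    exact measurableSet_setOf.2 ((measurableSet_setOf.1 h1).and (measurableSet_setOf.1 h2))
  have hJ : Measurable fun q : Cfg N × Die => (hsDiameter σ N)⁻¹ • geo.sepVec (q.1 i).1 (q.1 j).1 :=
    (measurable_const (a := (hsDiameter σ N)⁻¹)).smul ((hG.measurable_sepVec_config i j).comp measurable_fst)
  unfold kmNormal
  exact measurable_dite_find
    (P := fun n (q : Cfg N × Die) => ‖q.2 n‖ ≤ 1 ∧ IsAdmissible σ N i j
      (Lambert.lift (‖(q.1 j).2 - (q.1 i).2‖⁻¹ • ((q.1 j).2 - (q.1 i).2)) (q.2 n)) q.1)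
    (F := fun n (q : Cfg N × Die) =>
      Lambert.lift (‖(q.1 j).2 - (q.1 i).2‖⁻¹ • ((q.1 j).2 - (q.1 i).2)) (q.2 n))
    (J := fun q : Cfg N × Die => (hsDiameter σ N)⁻¹ • geo.sepVec (q.1 i).1 (q.1 j).1) hP hL hJ

/-- **The pair rule `kmRule` of `Z*` is a jointly measurable `Driven` rule.** [folklore] -/
theorem measurableRule_kmRule (σ : ℝ) (N : ℕ) : Driven.MeasurableRule (kmRule σ N) := by
  intro i j
  have h := (measurable_kickAt σ N i j).fun_comp (measurable_fst.prodMk (measurable_kmNormal σ N i j))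
  exact h

/-! ## Discharge -/

/-- **`KickMatchedMeasurable` holds**: for `0 < σ < 1/2` the diameter `hsDiameter σ N ≤ σ < 1/2` keeps the torus
geometry hard-sphere regular (`Torus.isHardSphereRegular_geometry`), the torus geometry is measurable
(`Torus.isMeasurable_geometry`) and `kmRule` is a jointly measurable rule (`measurableRule_kmRule`), so the
time-`t` map of `kmFlow = Driven.flow geo ε (kmRule σ N)` is jointly measurable in (datum, dice) by
`Driven.measurable_flow`. [folklore] -/
theorem KickMatchedMeasurable_holds : KickMatchedMeasurable := by
  intro σ hσ hσ2 N t
  have hε : hsDiameter σ N < 2⁻¹ := by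
    have h := hsDiameter_le hσ.le N
    rw [inv_eq_one_div]
    exact h.trans_lt hσ2
  unfold kmFlow
  exact Driven.measurable_flow (Torus.isHardSphereRegular_geometry hε) Torus.isMeasurable_geometry
    (measurableRule_kmRule σ N) t

end Literature.MathematicalPhysics.KineticTheory
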